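import Literature.Barriers.MatrixMultiplication.RectangularBarrierCwChain
import Literature.Barriers.MatrixMultiplication.UniversalMethodBarrierCwTangent
import HarnessLib

/-!
# Preliminaries for the certified numerics of CLLZ Table 1 (`ω̂(2)` via `CW_q`)

Topic `Literature/Barriers/MatrixMultiplication`; support file for the DISCHARGE of the named fact
`CLLZ2025_omegaTwo_barrier_CW` of `RectangularBarrier.lean` (Christandl–Le Gall–Lysikov–Zuiddam 2025,
§4.4 Table 1). The generated row files `RectangularBarrierOmegaTwoCW{1,2,3}.lean` instantiate
`omegaHat_bigCw_ge_of_costs` (`RectangularBarrierCwChain.lean`) with `θ = (τ, 1 − 2τ, τ)` and rational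
dual certificates; this file isolates the four pieces of real arithmetic they share, so that each row
is pure `norm_num` arithmetic:

* `theta_mem_stdSimplex`, `theta_zero/one/two` — the weight vector `(τ, 1 − 2τ, τ)` as the function
  `fun i => if i = 1 then 1 − 2τ else τ`.
* `cost_le_of_bounds` — a cost `Σ wᵢ Xᵢ / log 2` is `≤ h` once `Xᵢ ≤ Uᵢ` and
  `Σ wᵢ Uᵢ ≤ h · 0.6931471803` (`Real.log_two_gt_d9`).
* `h_le_logb_of_le` — `h ≤ log₂ x` once `h · 0.6931471808 ≤ L ≤ log x` (`Real.log_two_lt_d9`).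
* `row_bound_of_le` — `b ≤ (log₂ x / h)(3 − θ₁)` once `b · h · 0.6931471808 ≤ L (3 − θ₁)`, `L ≤ log x`.

The logarithm certificates themselves use `log_le_of_le_taylor`, `le_log_of_taylor_le`,
`log_eq_mul_log_two_add` of `UniversalMethodBarrierCwTangent.lean`. Everything PROVED.

References: CLLZ 2025 = arXiv:2003.03019v2, §4.4 Table 1. [ChristandlLeGallLysikovZuiddam2025]
-/

noncomputable section

namespace Literature.Barriers.MatrixMultiplication

/-- The weight vector `(τ, 1 − 2τ, τ)` lies in the simplex for `0 ≤ τ ≤ ½`. [folklore] -/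
theorem theta_mem_stdSimplex {τ : ℝ} (h0 : 0 ≤ τ) (h1 : 2 * τ ≤ 1) :
    (fun i : Fin 3 => if i = 1 then 1 - 2 * τ else τ) ∈ stdSimplex ℝ (Fin 3) := by
  refine ⟨fun i => ?_, ?_⟩
  · show 0 ≤ (if i = 1 then 1 - 2 * τ else τ)
    split_ifs <;> linarith
  · rw [Fin.sum_univ_three, if_neg (by decide), if_pos rfl, if_neg (by decide)]
    ring

/-- Value of `(τ, 1 − 2τ, τ)` at `0`. [folklore] -/
theorem theta_zero {x y : ℝ} : (if (0 : Fin 3) = 1 then x else y) = y := if_neg (by decide)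

/-- Value of `(τ, 1 − 2τ, τ)` at `1`. [folklore] -/
theorem theta_one {x y : ℝ} : (if (1 : Fin 3) = 1 then x else y) = x := if_pos rfl

/-- Value of `(τ, 1 − 2τ, τ)` at `2`. [folklore] -/
theorem theta_two {x y : ℝ} : (if (2 : Fin 3) = 1 then x else y) = y := if_neg (by decide)

/-- **A cost bound from certified logarithms**: if `Xᵢ ≤ Uᵢ`, the weights are nonnegative, `h ≥ 0` and
`w₀U₀ + w₁U₁ + w₂U₂ ≤ h · 0.6931471803` (`≤ h log 2`), then `Σ wᵢ Xᵢ/log 2 ≤ h`. [folklore] -/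
theorem cost_le_of_bounds {w₀ w₁ w₂ X₀ X₁ X₂ U₀ U₁ U₂ h : ℝ} (hw₀ : 0 ≤ w₀) (hw₁ : 0 ≤ w₁)
    (hw₂ : 0 ≤ w₂) (h₀ : X₀ ≤ U₀) (h₁ : X₁ ≤ U₁) (h₂ : X₂ ≤ U₂) (hh0 : 0 ≤ h)
    (hh : w₀ * U₀ + w₁ * U₁ + w₂ * U₂ ≤ h * 0.6931471803) :
    w₀ * (X₀ / Real.log 2) + w₁ * (X₁ / Real.log 2) + w₂ * (X₂ / Real.log 2) ≤ h := by
  have hl := Real.log_two_gt_d9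
  have hl0 : 0 < Real.log 2 := by linarith
  have e : w₀ * (X₀ / Real.log 2) + w₁ * (X₁ / Real.log 2) + w₂ * (X₂ / Real.log 2) =
      (w₀ * X₀ + w₁ * X₁ + w₂ * X₂) / Real.log 2 := by
    field_simp
  rw [e, div_le_iff₀ hl0]
  have hX : w₀ * X₀ + w₁ * X₁ + w₂ * X₂ ≤ w₀ * U₀ + w₁ * U₁ + w₂ * U₂ :=
    add_le_add (add_le_add (mul_le_mul_of_nonneg_left h₀ hw₀) (mul_le_mul_of_nonneg_left h₁ hw₁))
      (mul_le_mul_of_nonneg_left h₂ hw₂)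
  have hhl : h * 0.6931471803 ≤ h * Real.log 2 := mul_le_mul_of_nonneg_left hl.le hh0
  linarith

/-- **`h ≤ log₂ x`** from `h · 0.6931471808 ≤ L ≤ log x` (`h ≥ 0`). [folklore] -/
theorem h_le_logb_of_le {x L h : ℝ} (hL : L ≤ Real.log x) (hh0 : 0 ≤ h) (hc : h * 0.6931471808 ≤ L) :
    h ≤ Real.logb 2 x := by
  have hl := Real.log_two_lt_d9
  have hl' := Real.log_two_gt_d9
  have hl0 : 0 < Real.log 2 := by linarith
  rw [Real.logb, le_div_iff₀ hl0]
  have : h * Real.log 2 ≤ h * 0.6931471808 := mul_le_mul_of_nonneg_left hl.le hh0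
  linarith

/-- **The row inequality**: `b ≤ (log₂ x / h) · ((1 + θ₁) + 2(1 − θ₁))` from
`b · h · 0.6931471808 ≤ L (3 − θ₁)`, `L ≤ log x`, `h > 0`, `θ₁ ≤ 1`, `b ≥ 0`. [folklore] -/
theorem row_bound_of_le {x L h θ1 b : ℝ} (hL : L ≤ Real.log x) (hh : 0 < h)
    (hθ1 : θ1 ≤ 1) (hb0 : 0 ≤ b) (hb : b * h * 0.6931471808 ≤ L * (3 - θ1)) :
    b ≤ Real.logb 2 x / h * ((1 + θ1) + 2 * (1 - θ1)) := by
  have hl := Real.log_two_lt_d9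
  have hl' := Real.log_two_gt_d9
  have hl0 : 0 < Real.log 2 := by linarith
  have e : Real.logb 2 x / h * ((1 + θ1) + 2 * (1 - θ1)) = Real.log x * (3 - θ1) / (Real.log 2 * h) := by
    rw [Real.logb]
    field_simp
    ring
  rw [e, le_div_iff₀ (by positivity)]
  have h3 : 0 ≤ 3 - θ1 := by linarith
  have step1 : b * (Real.log 2 * h) ≤ b * (0.6931471808 * h) :=
    mul_le_mul_of_nonneg_left (mul_le_mul_of_nonneg_right hl.le hh.le) hb0
  have step2 : L * (3 - θ1) ≤ Real.log x * (3 - θ1) := mul_le_mul_of_nonneg_right hL h3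
  nlinarith [step1, step2, hb]

end Literature.Barriers.MatrixMultiplication

end
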